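import Summits.Ventures.PercRepro.C025ProfilePLDCertificate

/-!
# THE RESIDUAL LIFT TABLE FOR «M ⊕ U_{3,5}» AT RANK ≤ 12 (night-3 g36)

`proofs/NIGHT3-G36-CEILING.md` §3.  A pointwise symmetrised certificate, for every canonical (PLD) instance `(lo, hi, δ)` of
`M ⊕ U_{3,5}` (`lo ≤ hi ≤ 15`, `δ ≤ 15`), as a nonnegative combination of the RESIDUAL instances `(lo', hi', δ')` of `M`
(the form `#RS ≤ #THI` of per-layer dominance) on `[0, 12]²` — one list of `(lo', hi', δ', N)` with a common denominator `D` per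
target (HiGHS vertex + exact rational reconstruction + exact pointwise re-verification, kit j336688, lab/certtab_res.py), verified
here by `decide`.  Fed to `PLDResCert.sum_le_of_cert_res` in `C025ProfilePLDResPlaneTwelve`.  Where the (PLD)-instance certificates of the lift
tower stop at rank 6 for `U_{2,3}` (the base map of g35 / g36), the residual ones exist at every rank probed (≤ 20).
No `def`, no `instance`, no notation.  Axioms: standard.
-/

open scoped Matroid

namespace PercRepro

open Finset ThmH

namespace PLDResLift

variable {α : Type} [DecidableEq α]

set_option maxRecDepth 16384 in
set_option maxHeartbeats 400000000 in
/-- THE RESIDUAL TABLE (part 14: δ ∈ [14, 15)): a pointwise symmetrised certificate in residual instances for every canonical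
target, as a finite computation. -/
theorem res_uniform_3_5_table_12_part14 :
    ∀ T : ℕ → ℕ → ℕ → ℕ × List (ℕ × ℕ × ℕ × ℕ), T = (fun lo hi δ : ℕ => if (lo, hi, δ) = (0, 0, 14) then (12, [(0, 10, 1, 5)]) else ((1 : ℕ), ([] : List (ℕ × ℕ × ℕ × ℕ)))) →
      ∀ lo ∈ range 16, ∀ hi ∈ range 16, ∀ δ ∈ Ico 14 15, lo ≤ hi →
      0 < (T lo hi δ).1 ∧
      ∀ x ∈ range 13, ∀ f ∈ range 13,
        (T lo hi δ).1 * (∑ i ∈ range 6, Nat.choose 5 i * (if lo ≤ x + min i 3 ∧ x + min i 3 ≤ hi ∧ (if lo = 0 then 0 else lo + hi + δ) ≤ (f + min (5 - i) 3) + (x + min i 3) then (f + min (5 - i) 3).choose δ else 0)) + (T lo hi δ).1 * (∑ i ∈ range 6, Nat.choose 5 i * (if lo ≤ f + min i 3 ∧ f + min i 3 ≤ hi ∧ (if lo = 0 then 0 else lo + hi + δ) ≤ (x + min (5 - i) 3) + (f + min i 3) then (x + min (5 - i) 3).choose δ else 0)) +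
          (((T lo hi δ).2).map (fun k : (ℕ × ℕ × ℕ × ℕ) => k.2.2.2 *
          ((if k.1 + k.2.2.1 ≤ f ∧ f ≤ k.2.1 + k.2.2.1 ∧ k.2.1 + 1 ≤ x then f.choose k.2.2.1 else 0) +
            (if k.1 + k.2.2.1 ≤ x ∧ x ≤ k.2.1 + k.2.2.1 ∧ k.2.1 + 1 ≤ f then x.choose k.2.2.1 else 0)))).sum ≤
        (T lo hi δ).1 * (∑ i ∈ range 6, Nat.choose 5 i * (if lo + δ ≤ f + min (5 - i) 3 ∧ f + min (5 - i) 3 ≤ hi + δ then (f + min (5 - i) 3).choose δ else 0)) + (T lo hi δ).1 * (∑ i ∈ range 6, Nat.choose 5 i * (if lo + δ ≤ x + min (5 - i) 3 ∧ x + min (5 - i) 3 ≤ hi + δ then (x + min (5 - i) 3).choose δ else 0)) +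
          (((T lo hi δ).2).map (fun k : (ℕ × ℕ × ℕ × ℕ) => k.2.2.2 *
          ((if k.1 ≤ x ∧ x ≤ k.2.1 ∧ k.2.1 + k.2.2.1 + 1 ≤ f then f.choose k.2.2.1 else 0) +
            (if k.1 ≤ f ∧ f ≤ k.2.1 ∧ k.2.1 + k.2.2.1 + 1 ≤ x then x.choose k.2.2.1 else 0)))).sum := by
  intro T hT
  subst hT
  decide

end PLDResLift

end PercRepro
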